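import Summits.RiemannHypothesis.RiemannHypothesis.Theorems.TiltedLandingLaw421R3SinkThinSig
import Summits.RiemannHypothesis.RiemannHypothesis.Theorems.TiltedLandingLaw421R3SinkFeed

/-!
# W-08 law421 line — regime 3′ SINK: #1258 «SinkFeed» RE-THREADED ON THE THIN STRIP («SinkFeedThin», C1 rh-idea-5 g41; support, K-image — namespace `RhW08.SinkThin` continued, so every name keeps its sketch-of-record spelling

`RhW08.SinkFeed.lcert_le_of_kernelDom` / `le_of_certificate` / `norm_farFieldAt_le_of_certificatesExist` with the THIN kernel hypothesis
`(hK : KernelDomThin v.re R Hs cs w σ)` in place of `KernelDom v.re R cs w σ`: the far zeros of a legal frame satisfy `|Im u| ≤ Hs` (frame hypothesis,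
`EngineHyps5`), so they lie in «SinkThin»'s `ThinStrip v.re R Hs` (`thinStrip_of_far`) and the assembly is «SinkThin»'s `assembly_thin` — these are the
only two changed lines against #1258.  The consumer ★★ `norm_farFieldAt_le_of_certificatesExistThin` takes «SinkThinSig»'s `CertificatesExistThinSig lam`
and the ONE binder `(hHR : 2 * (Hs + hmax) ≤ R)` and delivers the sink inequality `‖farFieldAt f j v w‖ ≤ lam·η/s` at every simple state strictly below
the lid.  All (K), sorry-free; nothing here asserts `CertificatesExistThinSig`; RH is not proved here or anywhere in this line; ⟨33346⟩/⟨33347⟩ OPEN.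
-/

namespace RhW08.SinkThin

open Complex
open scoped ComplexConjugate
open RhW08.SinkTemplate RhW08.SinkBdry RhW08.SinkConePos RhW08.SinkMirror

/-! ## §5 #1280 «SinkFeed» re-threaded on the thin strip: (K) on `ThinStrip v.re R Hs` ⇒ `L_cert ≤ η/s` ⇒ the sink inequality -/

section Feed

open Filter Topology Set
open RhW08.Round1 RhW08.StSwap RhW08.Round2 RhW08.QuadW
open RhW08.SealSwap (PBot)
open RhW08.SealSwapQ RhW08.RateSplit RhW08.IsolatedTilt RhW08.FarStep RhW08.BurgersRate RhW08.PurseP RhW08.BurgersRateG3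
open RhIdea6.G17.W07C7 RhIdea6.G17.W07C7.Rev6 RhIdea6.G18.W07C8.Law421BirthS RhIdea6.G19.W07C11.Seam
open RhIdea6.G20.W07C12.Frac RhIdea6.G20.W07C12.StColP RhW07.C12.FieldSplit RhIdea6.G21.W07C13.TentMax
open RhW07.C14.TwoSided RhW07.C14.Classes RhW07.C14.Lineage RhW07.C14.Booking
open RhW08.FLink RhW08.FLinkGain RhW08.FLinkGainSeam
open RhW08.SinkFeed RhW08.FarPricing

/-- ★ (K) KERNEL DOMINATION ON THE THIN STRIP ⇒ `L_cert ≤ η/s` — #1280's `lcert_le_of_kernelDom` VERBATIM except that (K) is asked on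
`ThinStrip v.re R Hs` (the far zeros `a i` have `R/2 ≤ |Re aᵢ − Re v|` from the far clause and `|Im aᵢ| ≤ Hs` from the engine — `thinStrip_of_far`)
and the assembly is `assembly_thin`.  Two changed lines in a 130-line proof; everything else is #1280's. -/
theorem lcert_le_of_kernelDomThin {η : ℝ} {f : ℂ → ℂ} {x₀ s hmax R Hs : ℝ} {B : ℕ} (hE : EngineHyps5 2 η f x₀ s hmax R Hs B) {j : ℕ}
    {v w : ℂ} (hRB : LevelRemainderBox η f x₀ s hmax R j) (hcol : |v.re - x₀| ≤ R / 2) (hFv : iteratedDeriv j f v = 0)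
    (hv0 : 0 < v.im) (hs : iteratedDeriv (j + 1) f v ≠ 0)
    (hiso : ∀ z : ℂ, iteratedDeriv j f z = 0 → |z.re - v.re| < R / 2 → z = v ∨ z = conj v)
    (hw : iteratedDeriv j f w ≠ 0) (hwim : 0 < w.im) (hwre : |w.re - v.re| ≤ R / 3)
    {κ : Type} [Fintype κ] {cs : κ → Cut} (hadm : CutsAdmissible v.re cs) (hp0 : ∀ k, iteratedDeriv j f (cs k).p ≠ 0)
    (hpim : ∀ k, 0 < (cs k).p.im ∧ (cs k).p.im ≤ hmax) {σ : ℝ} (hK : KernelDomThin v.re R Hs cs w σ) :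
    Lcert cs (lineRem f j v R w) σ ≤ η / s := by
  obtain ⟨ι, a, hfar, -, -, hexp, htwo, hpull⟩ := im_lineRem_eq_farPull hE hFv hv0 hs hiso
  have hR : 0 < R := RhW08.ClusterQ.R_pos_of_engine hE
  have hHs0 : 0 ≤ Hs := hE.2.2.2.2.2.2.2.1
  have hHsR : 2 * Hs ≤ R := hE.2.2.2.2.2.2.2.2.2.1
  -- the reflection-symmetric multiplicity of the export
  set n : ℂ → ℝ := fun c ↦ (if c = v ∨ c = conj v then (0 : ℝ) else (analyticOrderNatAt (iteratedDeriv j f) c : ℝ)) with hndef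
  have hn : ∀ c, n (conj c) = n c := by
    intro c
    have h1 : (conj c = v ∨ conj c = conj v) ↔ (c = v ∨ c = conj v) := by
      constructor
      · rintro (h | h)
        · exact Or.inr (by rw [← h, conj_conj])
        · exact Or.inl (by simpa using congrArg conj h)
      · rintro (h | h)
        · exact Or.inr (by rw [h])
        · exact Or.inl (by rw [h, conj_conj])
    simp only [hndef, h1, analyticOrderNatAt, analyticOrderAt_conj_eq hE]
  -- the list: far, in the strip, reflected entries are zeros too; non-zeros avoid the list and its reflection
  have hnz : iteratedDeriv j f ≠ 0 := fun h ↦ hw (by rw [h]; rfl)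
  have hfar' : ∀ i, R / 2 ≤ |(a i).re - v.re| := fun i ↦ (hfar i).2
  have hstripa : ∀ i, |(a i).im| ≤ Hs := fun i ↦ RhW08.Column.abs_im_le_of_level hE hnz (hfar i).1
  have hconj0 : ∀ i, iteratedDeriv j f (conj (a i)) = 0 := fun i ↦ by rw [iteratedDeriv_conj hE, (hfar i).1, map_zero]
  have hav : ∀ {z : ℂ}, iteratedDeriv j f z ≠ 0 → ∀ i, z ≠ a i := fun hz i h ↦ hz (by rw [h]; exact (hfar i).1)
  have havc : ∀ {z : ℂ}, iteratedDeriv j f z ≠ 0 → ∀ i, z ≠ conj (a i) := fun hz i h ↦ hz (by rw [h]; exact hconj0 i)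
  -- the cut points: on the axis, in the slab
  have hpre : ∀ k, (cs k).p.re = v.re := fun k ↦ (hadm.1 k).2.2
  have hpslab : ∀ k, |(cs k).p.re - v.re| ≤ R / 3 := fun k ↦ by
    rw [hpre k, sub_self, abs_zero]; positivity
  -- reference summability `Σ 1/‖w − aᵢ‖² < ∞` via an auxiliary non-zero `z' ≠ w`, and the reflected-source domination constant
  obtain ⟨z', hz'0, hz'im, hz'w⟩ := exists_ne_nonzero hE j hw hwim
  have hsq : Summable (fun i ↦ 1 / (‖w - a i‖ * ‖w - a i‖)) :=
    summable_inv_norm_sq hR hfar' hwre (hav hw) (hav hz'0)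
      (summable_inv_norm_mul hz'w.symm (hav hw) (hav hz'0) (htwo w z' hw hwim hz'0 hz'im).1)
  set K : ℝ := 1 + 12 * Hs / R with hKdef
  have hdom : ∀ {p q : ℂ}, |p.re - v.re| ≤ R / 3 → |q.re - v.re| ≤ R / 3 → iteratedDeriv j f p ≠ 0 → iteratedDeriv j f q ≠ 0 →
      ∀ i, 1 / (‖p - conj (a i)‖ * ‖q - conj (a i)‖) ≤ K ^ 2 * (1 / (‖p - a i‖ * ‖q - a i‖)) :=
    fun hp hq hp0' hq0' i ↦ inv_norm_mul_conj_le hR (hfar' i) (hstripa i) hp hq (hav hp0' i) (hav hq0' i) (havc hp0' i) (havc hq0' i)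
  -- (a) the pull at `w` and its reflected twin are summable
  have hSw0 : Summable (fun i ↦ (1 / (w - a i)).im) := (hpull w hw hwim hwre).1
  have hSw : Summable (fun i ↦ (1 / (w - conj (a i))).im) := by
    refine Summable.of_norm_bounded ((hsq.mul_left (K ^ 2)).mul_left (|w.im| + Hs)) fun i ↦ ?_
    rw [Real.norm_eq_abs]
    have h1 := abs_im_one_div_sub_le (w := w) (a := conj (a i)) (Hs := Hs) hR (by rw [conj_re]; exact hfar' i)
      (by rw [conj_im, abs_neg]; exact hstripa i) hwre (havc hw i)
    rw [sub_self, norm_zero, mul_zero, zero_div, add_zero, one_pow, mul_one] at h1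
    exact h1.trans (mul_le_mul_of_nonneg_left (hdom hwre hwre hw hw i) (add_nonneg (abs_nonneg _) hHs0))
  -- (b) the two-point differences at `(w, p_k)` and their reflected twins are summable
  have hSc : ∀ k, Summable (fun i ↦ (1 / (w - conj (a i)) - 1 / ((cs k).p - conj (a i)))) := by
    intro k
    by_cases hwp : w = (cs k).p
    · rw [← hwp]
      simp only [sub_self]
      exact summable_zero
    have h1 := summable_inv_norm_mul hwp (hav hw) (hav (hp0 k)) (htwo w (cs k).p hw hwim (hp0 k) (hpim k).1).1
    refine Summable.of_norm_bounded ((h1.mul_left (K ^ 2)).mul_left ‖(cs k).p - w‖) fun i ↦ ?_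
    have e1 : w - conj (a i) ≠ 0 := sub_ne_zero.mpr (havc hw i)
    have e2 : (cs k).p - conj (a i) ≠ 0 := sub_ne_zero.mpr (havc (hp0 k) i)
    have : 1 / (w - conj (a i)) - 1 / ((cs k).p - conj (a i)) = ((cs k).p - w) / ((w - conj (a i)) * ((cs k).p - conj (a i))) := by
      field_simp
      ring
    rw [this, norm_div, norm_mul, div_eq_mul_one_div]
    exact mul_le_mul_of_nonneg_left (hdom hwre (hpslab k) hw (hp0 k) i) (norm_nonneg _)
  -- the pair kernel splits into the list term and its reflected twin
  have hpk : ∀ k i, farPairK (a i) w - farPairK (a i) (cs k).p =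
      (1 / (w - a i) - 1 / ((cs k).p - a i)) + (1 / (w - conj (a i)) - 1 / ((cs k).p - conj (a i))) := by
    intro k i
    unfold farPairK
    ring
  -- real parts along a direction
  have hgk : ∀ k, Summable (fun i ↦ (conj (cs k).e * (1 / (w - a i) - 1 / ((cs k).p - a i))).re) := fun k ↦
    (Complex.hasSum_re (((htwo w (cs k).p hw hwim (hp0 k) (hpim k).1).1).mul_left _).hasSum).summable
  have hgkc : ∀ k, Summable (fun i ↦ (conj (cs k).e * (1 / (w - conj (a i)) - 1 / ((cs k).p - conj (a i)))).re) := fun k ↦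
    (Complex.hasSum_re ((hSc k).mul_left _).hasSum).summable
  -- re-pairing: the reflected twins sum to the same value
  have hrep : ∀ k, ∑' i, (conj (cs k).e * (1 / (w - conj (a i)) - 1 / ((cs k).p - conj (a i)))).re =
      ∑' i, (conj (cs k).e * (1 / (w - a i) - 1 / ((cs k).p - a i))).re := fun k ↦
    tsum_conj_eq (g := fun c ↦ (conj (cs k).e * (1 / (w - c) - 1 / ((cs k).p - c))).re) hn hexp (hgk k) (hgkc k)
  have hrepI : ∑' i, (1 / (w - conj (a i))).im = ∑' i, (1 / (w - a i)).im :=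
    tsum_conj_eq (g := fun c ↦ (1 / (w - c)).im) hn hexp hSw0 hSw
  -- the hypotheses of `AssemblySig`, one by one
  have hm : ∀ _ : ι, (0 : ℝ) ≤ 1 / 2 := fun _ ↦ by norm_num
  have hstrip : ∀ i, ThinStrip v.re R Hs (a i) := fun i ↦ ⟨hfar' i, hstripa i⟩
  have hsum : ∀ k, Summable fun i ↦ (1 / 2 : ℝ) * (conj (cs k).e * (farPairK (a i) w - farPairK (a i) (cs k).p)).re := by
    intro k
    refine (((hgk k).add (hgkc k)).mul_left (1 / 2)).congr fun i ↦ ?_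
    rw [hpk k i, mul_add (conj (cs k).e), add_re]
  have hsumc : Summable fun i ↦ (1 / 2 : ℝ) * farPairC w (a i) := by
    refine ((hSw0.add hSw).mul_left (-(1 / 2))).congr fun i ↦ ?_
    simp only [farPairC, farPairK, add_im]
    ring
  have hEq : -(lineRem f j v R w).im = ∑' i, (1 / 2 : ℝ) * farPairC w (a i) := by
    have e1 : ∀ i, (1 / 2 : ℝ) * farPairC w (a i) = -(1 / 2) * ((1 / (w - a i)).im + (1 / (w - conj (a i))).im) := by
      intro i
      simp only [farPairC, farPairK, add_im]
      ring
    rw [tsum_congr e1, tsum_mul_left, hSw0.tsum_add hSw, hrepI, (hpull w hw hwim hwre).2.1]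
    ring
  have hseam : ∀ k, (conj (cs k).e * lineRem f j v R w).re -
      ∑' i, (1 / 2 : ℝ) * (conj (cs k).e * (farPairK (a i) w - farPairK (a i) (cs k).p)).re ≤ η / s := by
    intro k
    have e1 : ∀ i, (1 / 2 : ℝ) * (conj (cs k).e * (farPairK (a i) w - farPairK (a i) (cs k).p)).re =
        (1 / 2 : ℝ) * ((conj (cs k).e * (1 / (w - a i) - 1 / ((cs k).p - a i))).re +
          (conj (cs k).e * (1 / (w - conj (a i)) - 1 / ((cs k).p - conj (a i)))).re) := by
      intro i
      rw [hpk k i, mul_add (conj (cs k).e), add_re]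
    obtain ⟨hd, hid⟩ := htwo w (cs k).p hw hwim (hp0 k) (hpim k).1
    have e2 : ∑' i, (conj (cs k).e * (1 / (w - a i) - 1 / ((cs k).p - a i))).re =
        (conj (cs k).e * (lineRem f j v R w - lineRem f j v R (cs k).p)).re := by
      rw [hid, ← tsum_mul_left, Complex.re_tsum (hd.mul_left _)]
    rw [tsum_congr e1, tsum_mul_left, (hgk k).tsum_add (hgkc k), hrep k, e2]
    have hseamk : ‖lineRem f j v R (cs k).p‖ ≤ η / s :=
      norm_lineRem_le_of_seam hRB (hpre k) hcol (by rw [abs_of_pos (hpim k).1]; exact (hpim k).2) (hp0 k)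
    have hre : (conj (cs k).e * lineRem f j v R (cs k).p).re ≤ η / s := by
      refine (Complex.re_le_norm _).trans ?_
      rw [norm_mul, Complex.norm_conj, (hadm.1 k).2.1, one_mul]
      exact hseamk
    have e3 : (conj (cs k).e * lineRem f j v R w).re -
        1 / 2 * ((conj (cs k).e * (lineRem f j v R w - lineRem f j v R (cs k).p)).re +
          (conj (cs k).e * (lineRem f j v R w - lineRem f j v R (cs k).p)).re) =
        (conj (cs k).e * lineRem f j v R (cs k).p).re := by
      rw [mul_sub, sub_re]
      ring
    rw [e3]
    exact hre
  exact assembly_thin κ ι a (fun _ ↦ 1 / 2) v.re R Hs cs w (lineRem f j v R w) (η / s) σ hm hstrip hadm hK hsum hsumc hEq hseam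

/-- ★ (K) thin certificate ⇒ sink inequality (#1280's `le_of_certificate` with the thin (K)). -/
theorem le_of_certificate_thin {η : ℝ} {f : ℂ → ℂ} {x₀ s hmax R Hs : ℝ} {B : ℕ} (hE : EngineHyps5 2 η f x₀ s hmax R Hs B)
    {j : ℕ} {v w : ℂ} (hRB : LevelRemainderBox η f x₀ s hmax R j) (hcol : |v.re - x₀| ≤ R / 2) (hFv : iteratedDeriv j f v = 0)
    (hv0 : 0 < v.im) (hs : iteratedDeriv (j + 1) f v ≠ 0)
    (hiso : ∀ z : ℂ, iteratedDeriv j f z = 0 → |z.re - v.re| < R / 2 → z = v ∨ z = conj v)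
    (hw : iteratedDeriv j f w ≠ 0) (hwim : 0 < w.im) (hwre : |w.re - v.re| ≤ R / 3)
    {κ : Type} [Fintype κ] {cs : κ → Cut} (hadm : CutsAdmissible v.re cs) (hp0 : ∀ k, iteratedDeriv j f (cs k).p ≠ 0)
    (hpim : ∀ k, 0 < (cs k).p.im ∧ (cs k).p.im ≤ hmax) {σ lam gnorm : ℝ} (hlam : 0 < lam) (hK : KernelDomThin v.re R Hs cs w σ)
    (hD : DatumAlt lam s gnorm cs (lineRem f j v R w) σ) : gnorm ≤ lam * η / s := by
  have hL := lcert_le_of_kernelDomThin hE hRB hcol hFv hv0 hs hiso hw hwim hwre hadm hp0 hpim hK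
  have hs0 : 0 < s := hE.2.2.2.1
  have hη2 : 2 * η ≤ 1 := hE.2.2.2.2.2.2.2.2.2.2.2.2.2.2.1
  rcases hD with h | h
  · have h' := h.trans hL
    rw [div_le_iff₀ hlam] at h'
    calc gnorm ≤ η / s * lam := h'
      _ = lam * η / s := by ring
  · exfalso
    have h1 : 1 / (2 * s) < η / s := h.trans_le hL
    rw [div_lt_div_iff₀ (by positivity) hs0] at h1
    nlinarith

/-- ★ (K) the THIN claim `CertificatesExistThinSig lam` CLOSES THE SINK at a simple state strictly below the lid, on every frame with `2·(Hs + hmax) ≤ R` (E1′ — the only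
extra frame fact; `0 ≤ Hs` is `EngineHyps5` conjunct 8) (#1280's `norm_farFieldAt_le_of_certificatesExist` with the thin claim; at the Ξ frame of `closes`: hmax = Hs = 1/2, R = 135,
2·(1/2 + 1/2) ≤ 135). -/
theorem norm_farFieldAt_le_of_certificatesExistThin {lam : ℝ} (hcert : CertificatesExistThinSig lam) (hlam : 0 < lam) {η : ℝ} {f : ℂ → ℂ}
    {x₀ s hmax R Hs : ℝ} {B : ℕ} (hE : EngineHyps5 2 η f x₀ s hmax R Hs B) {j : ℕ} {v w : ℂ} (hRB : LevelRemainderBox η f x₀ s hmax R j)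
    (hcol : |v.re - x₀| ≤ R / 2) (hFv : iteratedDeriv j f v = 0) (hv0 : 0 < v.im) (hvh : v.im < hmax) (hs : iteratedDeriv (j + 1) f v ≠ 0)
    (hiso : ∀ z : ℂ, iteratedDeriv j f z = 0 → |z.re - v.re| < R / 2 → z = v ∨ z = conj v)
    (hw : iteratedDeriv j f w ≠ 0) (hw' : iteratedDeriv (j + 1) f w = 0) (hwim : 0 < w.im) (hdrop : v.im - s / 4 < w.im)
    (hdisc : ‖w - (v.re : ℂ)‖ ≤ |v.im|) (hHR : 2 * (Hs + hmax) ≤ R) : ‖farFieldAt f j v w‖ ≤ lam * η / s := by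
  have hs0 : 0 < s := hE.2.2.2.1
  have h2s : 2 * s ≤ hmax := hE.2.2.2.2.1
  have h3R : 3 * hmax < R := hE.2.2.2.2.2.2.1
  have hR : 0 < R := RhW08.ClusterQ.R_pos_of_engine hE
  -- the nested disc in coordinates
  have hdisc' : ‖w - (v.re : ℂ)‖ ≤ v.im := by rwa [abs_of_pos hv0] at hdisc
  have hn2 : ‖w - (v.re : ℂ)‖ ^ 2 = (w.re - v.re) ^ 2 + w.im ^ 2 := by
    rw [Complex.sq_norm, Complex.normSq_apply]
    simp
    ring
  have hsq : (w.re - v.re) ^ 2 + w.im ^ 2 ≤ v.im ^ 2 := by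
    rw [← hn2]
    exact pow_le_pow_left₀ (norm_nonneg _) hdisc' 2
  have hwle : w.im ≤ v.im := by
    have h := abs_le_of_sq_le_sq (a := w.im) (b := v.im) (by nlinarith [sq_nonneg (w.re - v.re)]) hv0.le
    rwa [abs_of_pos hwim] at h
  have hwlt : w.im < v.im := by
    rcases lt_or_eq_of_le hwle with h | h
    · exact h
    · exfalso
      have hre : (w.re - v.re) ^ 2 ≤ 0 := by nlinarith
      have hre0 : w.re - v.re = 0 := pow_eq_zero_iff two_ne_zero |>.mp (le_antisymm hre (sq_nonneg _))
      exact hw (by rw [Complex.ext (by linarith) h]; exact hFv)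
  have hwre : |w.re - v.re| ≤ R / 3 := by
    have h1 : |w.re - v.re| ≤ v.im := abs_le_of_sq_le_sq (by nlinarith [sq_nonneg w.im]) hv0.le
    linarith
  -- C3's certificate for multiplicity 1
  obtain ⟨n, cs, σ, hadm, hpts, hK, hD⟩ :=
    hcert v.re R s hmax Hs v w 1 hs0 h2s h3R hE.2.2.2.2.2.2.2.1 hHR rfl hv0 hvh.le hwim hwlt hdrop hsq le_rfl
  -- the cut points are non-zeros of the box, off `v`
  have hpfacts : ∀ k, iteratedDeriv j f (cs k).p ≠ 0 ∧ 0 < (cs k).p.im ∧ (cs k).p.im ≤ hmax := by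
    intro k
    have hoff : ∀ p : ℂ, p.re = v.re → 0 < p.im → p.im ≠ v.im → iteratedDeriv j f p ≠ 0 := by
      intro p hpre hpim hpv hz
      rcases hiso p hz (by rw [hpre, sub_self, abs_zero]; linarith) with h | h
      · exact hpv (by rw [h])
      · have : p.im = -v.im := by rw [h, conj_im]
        linarith
    rcases hpts k with h | h
    · have hre : (cs k).p.re = v.re := by rw [h]
      have him : (cs k).p.im = w.im := by rw [h]
      exact ⟨hoff _ hre (by rw [him]; exact hwim) (by rw [him]; exact hwlt.ne), by rw [him]; exact hwim, by rw [him]; linarith⟩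
    · have hre : (cs k).p.re = v.re := by rw [h]
      have him : (cs k).p.im = hmax := by rw [h]
      exact ⟨hoff _ hre (by rw [him]; linarith) (by rw [him]; exact hvh.ne'), by rw [him]; linarith, by rw [him]⟩
  -- the read value of the certificate is the line remainder, the bounded modulus is the far field (m = 1)
  have hL1 : lineRem f j v R w = -(farPairK v w) := by
    rw [lineRem_eq_farFieldAt_of_simple hE hFv hs hv0 hiso, farFieldAt_child v hw', farPairK]
    simp only [one_div]
  have hN : ‖farPairK v w‖ = ‖farFieldAt f j v w‖ := by
    rw [← lineRem_eq_farFieldAt_of_simple hE hFv hs hv0 hiso, hL1, norm_neg]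
  rw [Nat.cast_one, one_mul, ← hL1, hN] at hD
  exact le_of_certificate_thin hE hRB hcol hFv hv0 hs hiso hw hwim hwre hadm (fun k ↦ (hpfacts k).1) (fun k ↦ (hpfacts k).2) hlam hK hD

end Feed

end RhW08.SinkThin
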